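import Mathlib.Algebra.Group.Subgroup.Basic
import Mathlib.Algebra.Group.Units.Hom
import Literature.AlgebraicGeometry.Frobenioids.Monoids
import Literature.AlgebraicGeometry.Frobenioids.ModelFrobenioid
import HarnessLib

/-!
# Frobenioids I, §5: units and rational functions of the model Frobenioid, explicitly (Thm. 5.2 (ii))

Mochizuki, *The geometry of Frobenioids I: the general theory*, Kyushu J. Math. **62** (2008),
§5, Theorem 5.2 (ii), kurims text p. 101 [cite: MochizukiFrdI2008, Thm. 5.2(ii) p.101]:
"there is a natural isomorphism of functors between the functor `O^×(−)` on `D` associated to the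
Frobenioid `C^birat` […] and the functor `B`; this isomorphism is compatible with the homomorphisms
`O^×(−) → Φ^gp` […], `Div_B : B → Φ^gp`."  For the model Frobenioid `C = ModelFrobenioid Φ B Div_B`
of Theorem 5.2 (i) (`ModelFrobenioid.lean`) everything in that sentence is explicit, and this file
records the explicit form — the part of the Frobenioid-level vocabulary of [FrdI] Def. 1.2 (ii)
(`O^×(A)`, base-identity linear automorphisms) and of [EtTh] §4–5 (`O^×(A^birat)`, "the natural
inclusion `O^×(A) ↪ O^×(A^birat)`", pull-back of units along a morphism) that the [EtTh] §5 interface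
`EtaleTheta.FrobenioidTheta.TemperedFrobenioidStub` (seat abc-iut-L2-t4) asks for:

* `degFr_hom_eq_one` — automorphisms have Frobenius degree `1`;
* `units X : Subgroup (Aut X)` — `O^×(X)`, the base-identity linear automorphisms of `X = (A_D, α)`
  (the carrier of found's `PreFrobenioid.unitsSubgroup` for the functor `C → F_Φ` of Thm. 5.2 (i),
  written out so that this file depends on landed modules only);
* `unitsToRatFn X : units X →* (B(A_D))ˣ`, `α ↦ u_α` — "`O^×(A) ↪ O^×(A^birat) = B(A)`", a
  homomorphism, injective as soon as `Φ(A_D)` is integral (`unitsToRatFn_injective`), with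
  `Div_B(u_α) = Div(α)` (`divB_unitsToRatFn`) and `Div(α) = 0` when `Φ(A_D)` is sharp;
* `IsMulCommutative (units X)` — `O^×(A)` is abelian (here simply because `Φ(A_D)`, `B(A_D)` are);
* `unitsPull φ : units Y →* units X` for `φ : X ⟶ Y` — transport of units along a morphism,
  `u ↦ (1, id, Φ(Base φ)(Div u), B(Base φ)(u))`, with the intertwining relation
  `φ ≫ u = unitsPull φ u ≫ φ` for LINEAR `φ` (`comp_eq_unitsPull_comp`).

Multiplicative notation as in `ModelFrobenioid.lean` (`Div = 0 ↦ div = 1`); composition diagrammatic;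
`Aut X` multiplies by `α * β = β ≪≫ α` (Mathlib).  Nothing here needs `Φ` divisorial or `B`
group-like; the hypotheses `IsIntegral`/`IsSharp` appear only where used.  Deliberately NOT here: the
birationalization `C^birat` itself ([FrdI] Prop. 4.4, seat abc-iut-L1-t3) and the statement of
Thm. 5.2 (ii)–(iv) in general form (seat abc-iut-L1-t2); this file is consumer-side plumbing for the
[EtTh] §5 merge adapter (abc-iut cell, unit W2-L2-05).
-/

noncomputable section

namespace Literature.AlgebraicGeometry.Frobenioids

namespace ModelFrobenioid

open CategoryTheory Opposite

universe w v u

variable {D : Type u} [Category.{v} D] {Φ B : Dᵒᵖ ⥤ CommMonCat.{w}} {DivB : B ⟶ monoidGp Φ}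

/-! ### Automorphisms: Frobenius degree `1`, transport along identities -/

/-- `Φ(id_A)` is the identity of `Φ(A)`. [cite: MochizukiFrdI2008, Thm. 5.2(i) p.100] -/
theorem map_id_apply_Φ (A : D) (x : Φ.obj (op A)) : (Φ.map (𝟙 A).op).hom x = x := by
  rw [op_id, Φ.map_id, CommMonCat.hom_id, MonoidHom.id_apply]

/-- `B(id_A)` is the identity of `B(A)`. [cite: MochizukiFrdI2008, Thm. 5.2(i) p.100] -/
theorem map_id_apply_B (A : D) (u : B.obj (op A)) : (B.map (𝟙 A).op).hom u = u := by
  rw [op_id, B.map_id, CommMonCat.hom_id, MonoidHom.id_apply]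

/-- The two halves of an isomorphism of the model Frobenioid have Frobenius degree `1`
(`deg_Fr` is multiplicative and `deg_Fr(id) = 1`). [cite: MochizukiFrdI2008, Thm. 5.2(i) p.100] -/
theorem degFr_hom_eq_one {X Y : ModelFrobenioid Φ B DivB} (e : X ≅ Y) :
    degFr e.hom = 1 ∧ degFr e.inv = 1 := by
  have h : degFr e.inv * degFr e.hom = 1 := by rw [← degFr_comp, e.hom_inv_id, degFr_id]
  have h' : (degFr e.inv : ℕ) * (degFr e.hom : ℕ) = 1 := by rw [← PNat.mul_coe, h, PNat.one_coe]
  exact ⟨PNat.coe_eq_one_iff.mp (Nat.eq_one_of_mul_eq_one_left h'),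
    PNat.coe_eq_one_iff.mp (Nat.eq_one_of_mul_eq_one_right h')⟩

/-! ### `O^×(X)`: base-identity linear automorphisms (Def. 1.2 (ii) for the functor of Thm. 5.2 (i)) -/

/-- `O^×(X) ⊆ Aut_C(X)` for an object `X = (A_D, α)` of the model Frobenioid: the automorphisms with
`Base = id` and `deg_Fr = 1` ([FrdI] Def. 1.2 (ii), applied to the functor `C → F_Φ` of
Thm. 5.2 (i); same carrier as `PreFrobenioid.unitsSubgroup`). [cite: MochizukiFrdI2008, Thm. 5.2(ii) p.101] -/
def units (X : ModelFrobenioid Φ B DivB) : Subgroup (Aut X) where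
  carrier := {α | baseMap α.hom = 𝟙 X.base ∧ degFr α.hom = 1}
  one_mem' := ⟨rfl, rfl⟩
  mul_mem' := by
    rintro f g ⟨hf₁, hf₂⟩ ⟨hg₁, hg₂⟩
    refine ⟨?_, ?_⟩
    · show baseMap (g.hom ≫ f.hom) = 𝟙 _
      rw [baseMap_comp, hg₁, hf₁, Category.id_comp]
    · show degFr (g.hom ≫ f.hom) = 1
      rw [degFr_comp, hg₂, hf₂, mul_one]
  inv_mem' := by
    rintro f ⟨hf₁, -⟩
    refine ⟨?_, (degFr_hom_eq_one f).2⟩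
    have hb : baseMap (f.hom ≫ f.inv) = 𝟙 _ := by rw [Iso.hom_inv_id, baseMap_id]
    rw [baseMap_comp, hf₁, Category.id_comp] at hb
    exact hb

/-- Membership in `O^×(X)`. [cite: MochizukiFrdI2008, Thm. 5.2(ii) p.101] -/
theorem mem_units_iff {X : ModelFrobenioid Φ B DivB} (α : Aut X) :
    α ∈ units X ↔ baseMap α.hom = 𝟙 X.base ∧ degFr α.hom = 1 := Iff.rfl

/-- For `α ∈ O^×(X)` also `Base(α⁻¹) = id` and `deg_Fr(α⁻¹) = 1`. [cite: MochizukiFrdI2008, Thm. 5.2(ii) p.101] -/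
theorem baseMap_inv_of_mem_units {X : ModelFrobenioid Φ B DivB} {α : Aut X} (hα : α ∈ units X) :
    baseMap α.inv = 𝟙 X.base ∧ degFr α.inv = 1 :=
  (units X).inv_mem hα

/-- For `α ∈ O^×(X)`: `Div(α⁻¹) + Div(α) = 0` and `u_{α⁻¹} · u_α = 1` (read off `α ∘ α⁻¹ = id`).
[cite: MochizukiFrdI2008, Thm. 5.2(ii) p.101] -/
theorem div_inv_mul_div_of_mem_units {X : ModelFrobenioid Φ B DivB} {α : Aut X} (hα : α ∈ units X) :
    div α.inv * div α.hom = 1 ∧ unit α.inv * unit α.hom = 1 := by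
  have hd := congrArg div α.hom_inv_id
  have hu := congrArg unit α.hom_inv_id
  rw [div_comp, div_id, hα.1, (baseMap_inv_of_mem_units hα).2, PNat.one_coe, pow_one,
    map_id_apply_Φ] at hd
  rw [unit_comp, unit_id, hα.1, (baseMap_inv_of_mem_units hα).2, PNat.one_coe, pow_one,
    map_id_apply_B] at hu
  exact ⟨hd, hu⟩

/-- For `α ∈ O^×(X)` the relation (d) reads `Div(α) = Div_B(u_α)` in `Φ(A_D)^gp`.
[cite: MochizukiFrdI2008, Thm. 5.2(ii) p.101] -/
theorem of_div_eq_divB_unit_of_mem_units {X : ModelFrobenioid Φ B DivB} {α : Aut X}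
    (hα : α ∈ units X) :
    Algebra.GrothendieckGroup.of (div α.hom) = divB Φ B DivB (op X.base) (unit α.hom) := by
  have h := rel α.hom
  rw [hα.1, hα.2, PNat.one_coe, pow_one, pullGp_id] at h
  exact mul_left_cancel h

/-- `Div(α)` is a unit of `Φ(A_D)` for `α ∈ O^×(X)`; hence `Div(α) = 0` when `Φ(A_D)` is sharp
(as it is for a divisorial `Φ`, Def. 1.1 (i)). [cite: MochizukiFrdI2008, Thm. 5.2(ii) p.101] -/
theorem div_eq_one_of_mem_units {X : ModelFrobenioid Φ B DivB} (hΦ : IsSharp (Φ.obj (op X.base)))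
    {α : Aut X} (hα : α ∈ units X) : div α.hom = 1 :=
  hΦ.1 _ (IsUnit.of_mul_eq_one_right _ (div_inv_mul_div_of_mem_units hα).1)

/-! ### `O^×(X) → B(A_D)`: "`O^×(A) ↪ O^×(A^birat)`" (Thm. 5.2 (ii): `O^×(−)` on `C^birat` is `B`) -/

/-- `α ↦ u_α`, the homomorphism `O^×(X) → B(A_D)^×` realising "the natural inclusion
`O^×(A) ↪ O^×(A^birat)`" of [EtTh] §5 p.331 through the identification `O^×(A^birat) = B(A)` of
Thm. 5.2 (ii). [cite: MochizukiFrdI2008, Thm. 5.2(ii) p.101] -/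
def unitsToRatFn (X : ModelFrobenioid Φ B DivB) : units X →* (B.obj (op X.base))ˣ where
  toFun α := Units.mkOfMulEqOne (unit α.1.hom) (unit α.1.inv)
    (by rw [mul_comm]; exact (div_inv_mul_div_of_mem_units α.2).2)
  map_one' := Units.ext rfl
  map_mul' α β := by
    apply Units.ext
    change unit (β.1.hom ≫ α.1.hom) = unit α.1.hom * unit β.1.hom
    rw [unit_comp, β.2.1, α.2.2, PNat.one_coe, pow_one, map_id_apply_B]

/-- `unitsToRatFn` is `α ↦ u_α` on values. [cite: MochizukiFrdI2008, Thm. 5.2(ii) p.101] -/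
@[simp] theorem coe_unitsToRatFn {X : ModelFrobenioid Φ B DivB} (α : units X) :
    (unitsToRatFn X α : B.obj (op X.base)) = unit α.1.hom := rfl

/-- Compatibility of "`O^×(A) ↪ B(A)`" with `Div_B` and the zero divisor: `Div_B(u_α) = Div(α)`
("this isomorphism is compatible with … `Div_B : B → Φ^gp`", Thm. 5.2 (ii)).
[cite: MochizukiFrdI2008, Thm. 5.2(ii) p.101] -/
theorem divB_unitsToRatFn {X : ModelFrobenioid Φ B DivB} (α : units X) :
    divB Φ B DivB (op X.base) (unitsToRatFn X α) = Algebra.GrothendieckGroup.of (div α.1.hom) :=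
  (of_div_eq_divB_unit_of_mem_units α.2).symm

/-- For integral `Φ(A_D)` (e.g. `Φ` divisorial) `O^×(X) → B(A_D)^×` is injective: a base-identity
linear automorphism is determined by `u_α` ("the natural inclusion `O^×(A) ↪ O^×(A^birat)`",
[EtTh] §5 p.331). [cite: MochizukiFrdI2008, Thm. 5.2(ii) p.101] -/
theorem unitsToRatFn_injective {X : ModelFrobenioid Φ B DivB} (hΦ : IsIntegral (Φ.obj (op X.base))) :
    Function.Injective (unitsToRatFn X) := by
  intro α β h
  have hu : unit α.1.hom = unit β.1.hom := by
    rw [← coe_unitsToRatFn, ← coe_unitsToRatFn, h]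
  apply Subtype.ext
  apply Aut.ext
  apply hom_ext
  · rw [α.2.2, β.2.2]
  · rw [α.2.1, β.2.1]
  · apply hΦ.injective_of
    rw [of_div_eq_divB_unit_of_mem_units α.2, of_div_eq_divB_unit_of_mem_units β.2, hu]
  · exact hu

/-- `u_α ∈ Ker(Div_B)` for `α ∈ O^×(X)` when `Φ(A_D)` is sharp: `O^×(A)` lands in the kernel of
`B(A) → Φ(A)^gp` ("compatible with the homomorphisms `O^×(−) → Φ^gp`", Thm. 5.2 (ii)).
[cite: MochizukiFrdI2008, Thm. 5.2(ii) p.101] -/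
theorem divB_unitsToRatFn_eq_one {X : ModelFrobenioid Φ B DivB} (hΦ : IsSharp (Φ.obj (op X.base)))
    (α : units X) : divB Φ B DivB (op X.base) (unitsToRatFn X α) = 1 := by
  rw [divB_unitsToRatFn, div_eq_one_of_mem_units hΦ α.2, map_one]

/-! ### `O^×(X)` is abelian (Remark 1.3.1 for the model Frobenioid) -/

/-- `O^×(X)` is commutative: its elements are `(1, id, Div, u)` and both `Φ(A_D)`, `B(A_D)` are
commutative ([FrdI] Rmk. 1.3.1 asserts this for every Frobenioid; here it is immediate).
[cite: MochizukiFrdI2008, Thm. 5.2(ii) p.101] -/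
instance isMulCommutative_units (X : ModelFrobenioid Φ B DivB) : IsMulCommutative (units X) where
  is_comm := ⟨fun α β => by
    apply Subtype.ext
    apply Aut.ext
    change (β.1.hom ≫ α.1.hom) = (α.1.hom ≫ β.1.hom)
    apply hom_ext
    · rw [degFr_comp, degFr_comp, mul_comm]
    · rw [baseMap_comp, baseMap_comp, α.2.1, β.2.1]
    · rw [div_comp, div_comp, α.2.1, β.2.1, α.2.2, β.2.2, map_id_apply_Φ, map_id_apply_Φ,
        PNat.one_coe, pow_one, pow_one, mul_comm]
    · rw [unit_comp, unit_comp, α.2.1, β.2.1, α.2.2, β.2.2, map_id_apply_B, map_id_apply_B,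
        PNat.one_coe, pow_one, pow_one, mul_comm]⟩

/-! ### Base-identity linear endomorphisms and automorphisms from explicit data -/

/-- The base-identity endomorphism `(1, id, d, u)` of `X = (A_D, α)` for `d ∈ Φ(A_D)`, `u ∈ B(A_D)`
with `d = Div_B(u)` in `Φ(A_D)^gp` (relation (d) of Thm. 5.2 (i) with `deg_Fr = 1`, `Base = id`).
[cite: MochizukiFrdI2008, Thm. 5.2(i) p.100] -/
def unitEnd (X : ModelFrobenioid Φ B DivB) (d : Φ.obj (op X.base)) (u : B.obj (op X.base))
    (h : Algebra.GrothendieckGroup.of d = divB Φ B DivB (op X.base) u) : X ⟶ X where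
  degFr := 1
  base := 𝟙 X.base
  div := d
  unit := u
  rel := by rw [PNat.one_coe, pow_one, pullGp_id, h]

/-- Composition of two such endomorphisms multiplies the data. [cite: MochizukiFrdI2008, Thm. 5.2(i) p.100] -/
theorem unitEnd_comp (X : ModelFrobenioid Φ B DivB) (d d' : Φ.obj (op X.base))
    (u u' : B.obj (op X.base)) (h : Algebra.GrothendieckGroup.of d = divB Φ B DivB (op X.base) u)
    (h' : Algebra.GrothendieckGroup.of d' = divB Φ B DivB (op X.base) u')
    (h'' : Algebra.GrothendieckGroup.of (d' * d) = divB Φ B DivB (op X.base) (u' * u)) :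
    unitEnd X d u h ≫ unitEnd X d' u' h' = unitEnd X (d' * d) (u' * u) h'' := by
  apply hom_ext
  · rfl
  · exact Category.id_comp _
  · change (Φ.map (𝟙 X.base).op).hom d' * d ^ ((1 : ℕ+) : ℕ) = d' * d
    rw [map_id_apply_Φ, PNat.one_coe, pow_one]
  · change (B.map (𝟙 X.base).op).hom u' * u ^ ((1 : ℕ+) : ℕ) = u' * u
    rw [map_id_apply_B, PNat.one_coe, pow_one]

/-- `(1, id, 0, 1)` is the identity. [cite: MochizukiFrdI2008, Thm. 5.2(i) p.100] -/
theorem unitEnd_one (X : ModelFrobenioid Φ B DivB)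
    (h : Algebra.GrothendieckGroup.of (1 : Φ.obj (op X.base)) = divB Φ B DivB (op X.base) 1) :
    unitEnd X 1 1 h = 𝟙 X := rfl

/-- The relation `d = Div_B(u)` is multiplicative. [cite: MochizukiFrdI2008, Thm. 5.2(i) p.100] -/
theorem of_mul_eq_divB_mul {X : ModelFrobenioid Φ B DivB} {d d' : Φ.obj (op X.base)}
    {u u' : B.obj (op X.base)} (h : Algebra.GrothendieckGroup.of d = divB Φ B DivB (op X.base) u)
    (h' : Algebra.GrothendieckGroup.of d' = divB Φ B DivB (op X.base) u') :
    Algebra.GrothendieckGroup.of (d' * d) = divB Φ B DivB (op X.base) (u' * u) := by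
  rw [map_mul, map_mul, h, h']

/-- The base-identity linear AUTOMORPHISM with data `(1, id, d, u)` and inverse `(1, id, d', u')`,
for `d · d' = 0`… i.e. `d * d' = 1`, `u * u' = 1`. [cite: MochizukiFrdI2008, Thm. 5.2(ii) p.101] -/
def unitAut (X : ModelFrobenioid Φ B DivB) (d d' : Φ.obj (op X.base)) (u u' : B.obj (op X.base))
    (h : Algebra.GrothendieckGroup.of d = divB Φ B DivB (op X.base) u)
    (h' : Algebra.GrothendieckGroup.of d' = divB Φ B DivB (op X.base) u')
    (hd : d' * d = 1) (hu : u' * u = 1) : Aut X where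
  hom := unitEnd X d u h
  inv := unitEnd X d' u' h'
  hom_inv_id := by
    rw [unitEnd_comp X d d' u u' h h' (of_mul_eq_divB_mul h h')]
    have h1 : Algebra.GrothendieckGroup.of (1 : Φ.obj (op X.base)) = divB Φ B DivB (op X.base) 1 := by
      rw [map_one, map_one]
    rw [← unitEnd_one X h1]
    congr 1
  inv_hom_id := by
    rw [unitEnd_comp X d' d u' u h' h (of_mul_eq_divB_mul h' h)]
    have h1 : Algebra.GrothendieckGroup.of (1 : Φ.obj (op X.base)) = divB Φ B DivB (op X.base) 1 := by
      rw [map_one, map_one]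
    rw [← unitEnd_one X h1]
    congr 1
    · rw [mul_comm]; exact hd
    · rw [mul_comm]; exact hu

/-- `unitAut` lies in `O^×(X)`. [cite: MochizukiFrdI2008, Thm. 5.2(ii) p.101] -/
theorem unitAut_mem_units (X : ModelFrobenioid Φ B DivB) (d d' : Φ.obj (op X.base))
    (u u' : B.obj (op X.base)) (h : Algebra.GrothendieckGroup.of d = divB Φ B DivB (op X.base) u)
    (h' : Algebra.GrothendieckGroup.of d' = divB Φ B DivB (op X.base) u') (hd : d' * d = 1)
    (hu : u' * u = 1) : unitAut X d d' u u' h h' hd hu ∈ units X :=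
  ⟨rfl, rfl⟩

/-! ### Pull-back of units along a morphism -/

/-- Transport of the datum `d = Div_B(u)` along `f : A_D → A'_D`: `Φ(f)(d) = Div_B(B(f)(u))`
(naturality of `Div_B`). [cite: MochizukiFrdI2008, Thm. 5.2 p.100] -/
theorem of_map_eq_divB_map {A A' : D} (f : A ⟶ A') {d : Φ.obj (op A')} {u : B.obj (op A')}
    (h : Algebra.GrothendieckGroup.of d = divB Φ B DivB (op A') u) :
    Algebra.GrothendieckGroup.of ((Φ.map f.op).hom d) = divB Φ B DivB (op A) ((B.map f.op).hom u) := by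
  rw [← pullGp_of, h, pullGp_divB]

/-- **Pull-back of units** along a morphism `φ : X ⟶ Y` of the model Frobenioid:
`O^×(Y) → O^×(X)`, `(1, id, Div u, u) ↦ (1, id, Φ(Base φ)(Div u), B(Base φ)(u))` — the functoriality
of `O^×(−) = Ker(B → Φ^gp)` in Thm. 5.2 (ii) (used in [EtTh] §5 for linear morphisms: Prop. 5.5
"`μ_N(S) ⥲ μ_N(S'')`", p.328).  A group homomorphism.
[cite: MochizukiFrdI2008, Thm. 5.2(ii) p.101] -/
def unitsPull {X Y : ModelFrobenioid Φ B DivB} (φ : X ⟶ Y) : units Y →* units X where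
  toFun τ := ⟨unitAut X ((Φ.map (baseMap φ).op).hom (div τ.1.hom))
      ((Φ.map (baseMap φ).op).hom (div τ.1.inv)) ((B.map (baseMap φ).op).hom (unit τ.1.hom))
      ((B.map (baseMap φ).op).hom (unit τ.1.inv))
      (of_map_eq_divB_map _ (of_div_eq_divB_unit_of_mem_units τ.2))
      (of_map_eq_divB_map _ (of_div_eq_divB_unit_of_mem_units ((units Y).inv_mem τ.2)))
      (by rw [← map_mul, (div_inv_mul_div_of_mem_units τ.2).1, map_one])
      (by rw [← map_mul, (div_inv_mul_div_of_mem_units τ.2).2, map_one]),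
    unitAut_mem_units _ _ _ _ _ _ _ _ _⟩
  map_one' := by
    apply Subtype.ext
    apply Aut.ext
    apply hom_ext
    · rfl
    · rfl
    · change (Φ.map (baseMap φ).op).hom (div (𝟙 Y)) = div (𝟙 X)
      rw [div_id, div_id, map_one]
    · change (B.map (baseMap φ).op).hom (unit (𝟙 Y)) = unit (𝟙 X)
      rw [unit_id, unit_id, map_one]
  map_mul' σ τ := by
    apply Subtype.ext
    apply Aut.ext
    apply hom_ext
    · change (1 : ℕ+) = 1 * 1
      rw [mul_one]
    · change 𝟙 X.base = 𝟙 X.base ≫ 𝟙 X.base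
      rw [Category.id_comp]
    · change (Φ.map (baseMap φ).op).hom (div (τ.1.hom ≫ σ.1.hom)) =
        (Φ.map (𝟙 X.base).op).hom ((Φ.map (baseMap φ).op).hom (div σ.1.hom)) *
          ((Φ.map (baseMap φ).op).hom (div τ.1.hom)) ^ ((1 : ℕ+) : ℕ)
      rw [div_comp, τ.2.1, σ.2.2, map_id_apply_Φ, map_id_apply_Φ, PNat.one_coe, pow_one, pow_one,
        map_mul]
    · change (B.map (baseMap φ).op).hom (unit (τ.1.hom ≫ σ.1.hom)) =
        (B.map (𝟙 X.base).op).hom ((B.map (baseMap φ).op).hom (unit σ.1.hom)) *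
          ((B.map (baseMap φ).op).hom (unit τ.1.hom)) ^ ((1 : ℕ+) : ℕ)
      rw [unit_comp, τ.2.1, σ.2.2, map_id_apply_B, map_id_apply_B, PNat.one_coe, pow_one, pow_one,
        map_mul]

/-- The components of `unitsPull φ τ`: `Div = Φ(Base φ)(Div τ)`, `u = B(Base φ)(u_τ)`.
[cite: MochizukiFrdI2008, Thm. 5.2(ii) p.101] -/
theorem unitsPull_hom_div_unit {X Y : ModelFrobenioid Φ B DivB} (φ : X ⟶ Y) (τ : units Y) :
    div (unitsPull φ τ).1.hom = (Φ.map (baseMap φ).op).hom (div τ.1.hom) ∧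
      unit (unitsPull φ τ).1.hom = (B.map (baseMap φ).op).hom (unit τ.1.hom) :=
  ⟨rfl, rfl⟩

/-- `unitsToRatFn` intertwines `unitsPull φ` with `B(Base φ)`: `u_{φ^* τ} = B(Base φ)(u_τ)`
(naturality of "`O^×(−) ≅ B`", Thm. 5.2 (ii)). [cite: MochizukiFrdI2008, Thm. 5.2(ii) p.101] -/
theorem coe_unitsToRatFn_unitsPull {X Y : ModelFrobenioid Φ B DivB} (φ : X ⟶ Y) (τ : units Y) :
    (unitsToRatFn X (unitsPull φ τ) : B.obj (op X.base)) =
      (B.map (baseMap φ).op).hom (unitsToRatFn Y τ : B.obj (op Y.base)) := rfl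

/-- For a LINEAR `φ : X ⟶ Y` (`deg_Fr(φ) = 1`) the pulled-back unit intertwines: `φ ∘ (φ^* τ) = τ ∘ φ`,
i.e. `unitsPull φ τ ≫ φ = φ ≫ τ` — the sense in which `O^×(−)` is functorial for linear morphisms
([FrdI] Prop. 2.2 (ii)–(iii); [EtTh] Prop. 5.5, p.328). [cite: MochizukiFrdI2008, Thm. 5.2(ii) p.101] -/
theorem comp_eq_unitsPull_comp {X Y : ModelFrobenioid Φ B DivB} (φ : X ⟶ Y) (hφ : degFr φ = 1)
    (τ : units Y) : ((unitsPull φ τ).1.hom ≫ φ) = φ ≫ τ.1.hom := by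
  apply hom_ext
  · rw [degFr_comp, degFr_comp, τ.2.2, one_mul]
    exact mul_one _
  · rw [baseMap_comp, baseMap_comp, τ.2.1, Category.comp_id]
    exact Category.id_comp _
  · rw [div_comp, div_comp, (unitsPull_hom_div_unit φ τ).1, hφ, τ.2.2, PNat.one_coe, pow_one,
      pow_one, (unitsPull φ τ).2.1, map_id_apply_Φ, mul_comm]
  · rw [unit_comp, unit_comp, (unitsPull_hom_div_unit φ τ).2, hφ, τ.2.2, PNat.one_coe, pow_one,
      pow_one, (unitsPull φ τ).2.1, map_id_apply_B, mul_comm]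

end ModelFrobenioid

end Literature.AlgebraicGeometry.Frobenioids
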